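import Summits.BirchSwinnertonDyer.BirchSwinnertonDyer.Theorems.SylvesterTwoHeegnerIndexUpperDescentPoints
import Summits.BirchSwinnertonDyer.BirchSwinnertonDyer.Theorems.SylvesterTwoHeegnerIndexUpperDescentSylvester
import HarnessLib

/-!
# Route `SylvesterTwoHeegnerIndex` (rung K7t), crux `HeegnerIndexUpperAtTwoHSY` (item 19229), layer 2:
# `Ш(E_p/ℚ) → Ш(E_p/K′)` IS INJECTIVE for every Sylvester curve and every quadratic field `K′` over
# which `E_p` acquires no new rank — the descent step of the Kolyvagin road at `2`, instantiated

HONEST FRAMING (cell «bsd-cm», D-0074 seat `bsd-cm-k7t-c2`, item stmt-BirchSwinnertonDyer-19229; the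
crux — the Euler-system half of `BSD(E_p, 2)` on 𝒞_HSY — stays OPEN; nothing booked). This file closes
the instantiation left open in `…UpperDescentSylvester.lean` (§3 note: the `Algebra ℚ` instance diamond
on the Galois closure `K̃′ ⊆ ℚ̄` is bridged with `convert` and the `Rat.cast` form of the cubic
obstruction): for `W` any model of `E_p : x³ + y³ = p` (`p` an odd prime) and `K′` any number field whose
Galois closure `K̃′ ⊆ ℚ̄` has degree `2` over `ℚ` (every quadratic `K′`),
**`shaRestriction_injective_sylvester`: if every point of `E_p(K̃′)` has a positive multiple in `E_p(ℚ)`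
(the twist `E_p^{(d)}` has rank `0` — in a Heegner frame of the route: `L(E_p^{(d_{K′})}, 1) ≠ 0` +
Gross–Zagier–Kolyvagin / Burungale–Flach), then `Ш(E_p/ℚ) → Ш(E_p/K′)` is injective.** Ingredients:
`[Γ_ℚ : Γ_{K̃′}] = [K̃′ : ℚ]` (`index_galSubgroupClosure_eq_finrank`, Krull–Galois correspondence);
`E_p(K̃′)[2] = 0` (a `2`-torsion point of `y² = x³ − 432p²` gives `x³ = 432p²`, and `X³ − 432p²` is
irreducible over `ℚ` — `irreducible_X_pow_three_sub` — so no root in a quadratic field,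
`cube_ne_ratCast_of_finrank_two`); and the rational-points criterion
`shaRestriction_injective_of_torsion_quotient` (p421567). CONSEQUENCE for the crux: on 𝒞_HSY the `K′ → ℚ`
descent at `2` loses NO power of `2` (`ord₂ #Ш(E_p/ℚ) ≤ ord₂ #Ш(E_p/K′)` in every frame, modulo the
twin-rank input), so the open content of `HeegnerIndexUpperAtTwoHSY` is exactly a SHARP Kolyvagin bound
over the Heegner field at `p = 2` — the step for which print has only Kolyvagin ICM 1990 §2 with an
`E`-dependent constant. References: [GrossLMS1991] §2; [SerreGaloisCohomology1997] I.§5.8; [SilvermanAEC2009]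
III.2.3, VIII.§1, X.§4; Mathlib `IntermediateField.finrank_eq_fixingSubgroup_index`,
`X_pow_sub_C_irreducible_of_prime`; parents p420915, p421567, `…UpperDescentSylvester.lean`, k7t-c3's p417881.
-/

set_option autoImplicit false
set_option linter.dupNamespace false

noncomputable section

open scoped Classical Pointwise Polynomial

universe u

open Literature.NumberTheory.EllipticCurves Literature.NumberTheory.EllipticCurves.HuShuYin2019
  WeierstrassCurve Polynomial

namespace Summit.BirchSwinnertonDyer.BirchSwinnertonDyer.Theorems.SylvesterTwoUpper

/-! ## §1 The index of `Γ_{L̃}` is the degree `[L̃ : K]` -/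

/-- **`[Γ_K : Γ_{L̃}] = [L̃ : K]`** for a number field `K`, a field `L ⊇ K` and the Galois closure
`L̃ ⊆ K̄` of `L/K` (Krull's Galois correspondence for `K̄/K`, Mathlib
`IntermediateField.finrank_eq_fixingSubgroup_index`). So the index-`2` hypothesis of the descent
criteria is `[L̃ : K] = 2`, i.e. `L/K` quadratic. [folklore] -/
theorem index_galSubgroupClosure_eq_finrank {K : Type u} [Field K] [NumberField K]
    (L : Type u) [Field L] [Algebra K L] :
    (galSubgroupClosure (K := K) L).index = Module.finrank K (galoisClosureIn (K := K) L) := by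
  haveI : IsGalois K (AlgebraicClosure K) := {}
  exact (IntermediateField.finrank_eq_fixingSubgroup_index _).symm

/-! ## §2 No `x³ = 432p²` in a char-`0` field of `ℚ`-dimension `2` (`Rat.cast` form, instance-robust) -/

/-- **No `x ∈ F` with `x³ = 432p²` when `[F : ℚ] = 2`** — stated with the canonical `ℚ`-structure of a
characteristic-`0` field (`Rat.cast`), so that it applies to an intermediate field of `ℚ̄` whatever
`ℚ`-algebra instance is in use: a root of the irreducible `X³ − 432p²` (`irreducible_X_pow_three_sub`)
has minimal polynomial of degree `3 > 2` (`minpoly.natDegree_le`). [folklore] -/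
theorem cube_ne_ratCast_of_finrank_two {p : ℕ} (hp : p.Prime) (hp2 : p ≠ 2)
    (F : Type u) [Field F] [CharZero F] [Module.Finite ℚ F] (hF : Module.finrank ℚ F = 2)
    (x : F) : x ^ 3 ≠ ((432 * (p : ℚ) ^ 2 : ℚ) : F) := by
  intro hx
  have hmonic : (X ^ 3 - C (432 * (p : ℚ) ^ 2) : ℚ[X]).Monic := monic_X_pow_sub_C _ (by norm_num)
  have haeval : aeval x (X ^ 3 - C (432 * (p : ℚ) ^ 2) : ℚ[X]) = 0 := by
    simp only [map_sub, map_pow, aeval_X, aeval_C, eq_ratCast, hx, sub_self]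
  have hmin := minpoly.eq_of_irreducible_of_monic (irreducible_X_pow_three_sub hp hp2) haeval hmonic
  have hdeg := minpoly.natDegree_le (A := ℚ) x
  rw [← hmin, natDegree_X_pow_sub_C, hF] at hdeg
  omega

/-! ## §3 The descent for `E_p` along a quadratic field -/

/-- **`Ш(E_p/ℚ) → Ш(E_p/K′)` is INJECTIVE as soon as `E_p(K̃′)/E_p(ℚ)` is torsion.** For `p` an odd
prime, `W` any Weierstrass model over `ℚ` of `E_p : x³ + y³ = p`, `K′` a number field with `[K̃′ : ℚ] = 2`
(`K̃′ ⊆ ℚ̄` the Galois closure; every quadratic `K′`): if every point of `E_p(K̃′)` has a positive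
multiple coming from `E_p(ℚ)` (displayed input `htor`: the twist `E_p^{(d)}` has rank `0`, as in every
Heegner frame of the route), then the restriction `Ш(E_p/ℚ) → Ш(E_p/K′)` is injective — in particular
`ord₂ #Ш(E_p/ℚ) ≤ ord₂ #Ш(E_p/K′)`. Proof: `[Γ_ℚ : Γ_{K̃′}] = 2` (§1); `E_p(K̃′)[2] = 0` (proved inline
against the instances of the criterion's statement: `y = −y ⇒ x³ = 432p²`, excluded by §2; transport to
the model `W` by `VariableChange.pointEquiv`); then `shaRestriction_injective_of_torsion_quotient`.
[cite: GrossLMS1991, §2] [cite: SerreGaloisCohomology1997, I.§5.8] [cite: SilvermanAEC2009, III.2.3 and X.§4] -/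
theorem shaRestriction_injective_sylvester {p : ℕ} (hp : p.Prime) (hp2 : p ≠ 2)
    (W : WeierstrassCurve ℚ) (hW : ∃ C : VariableChange ℚ, C • W = cubeSumCurve (p : ℚ))
    (K' : Type) [Field K'] [NumberField K']
    (hL : Module.finrank ℚ (galoisClosureIn (K := ℚ) K') = 2)
    (htor : ∀ Q : (W.baseChange (galoisClosureIn (K := ℚ) K')).toAffine.Point,
      ∃ n : ℕ, 0 < n ∧ ∃ R : W.toAffine.Point,
        n • Q = Affine.Point.baseChange (W' := W) ℚ (galoisClosureIn (K := ℚ) K') R) :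
    Function.Injective (shaRestriction W K') := by
  have h2 : (galSubgroupClosure (K := ℚ) K').index = 2 := by
    rw [index_galSubgroupClosure_eq_finrank]; convert hL
  refine shaRestriction_injective_of_torsion_quotient W K' h2 htor ?_
  -- `E_p(K̃′)[2] = 0`, against the instances of the goal
  obtain ⟨C, hC⟩ := hW
  set F := (galoisClosureIn (K := ℚ) K') with hFdef
  intro Q hQ
  have heq : (C.map (algebraMap ℚ F)) • (W.baseChange F) = (cubeSumCurve (p : ℚ)).baseChange F := by
    rw [WeierstrassCurve.baseChange, WeierstrassCurve.map_variableChange, hC]; rfl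
  have htarget : ∀ R : ((C.map (algebraMap ℚ F)) • (W.baseChange F)).toAffine.Point,
      2 • R = 0 → R = 0 := by
    rw [heq]
    intro R hR
    rcases R with _ | ⟨x, y, h⟩
    · rfl
    · exfalso
      have hneg : (Affine.Point.some x y h : ((cubeSumCurve (p : ℚ)).baseChange F).toAffine.Point)
          = -Affine.Point.some x y h := by
        rw [← add_eq_zero_iff_eq_neg, ← two_nsmul]; exact hR
      rw [Affine.Point.neg_some, Affine.Point.some.injEq] at hneg
      have hy : y = 0 := by
        have h2 : y = -y := by
          have := hneg.2
          simpa [Affine.negY, cubeSumCurve, WeierstrassCurve.baseChange] using this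
        have h3 : (2 : F) * y = 0 := by linear_combination h2
        simpa using h3
      have heq' := (Affine.equation_iff x y).mp h.1
      simp [cubeSumCurve, WeierstrassCurve.baseChange, hy] at heq'
      apply cube_ne_ratCast_of_finrank_two hp hp2 F (by convert hL) x
      push_cast
      linear_combination -heq'
  exact SylvesterTwoLower.two_smul_eq_zero_imp_of_addEquiv
    (VariableChange.pointEquiv (W.baseChange F) (C.map (algebraMap ℚ F))).symm htarget Q hQ

end Summit.BirchSwinnertonDyer.BirchSwinnertonDyer.Theorems.SylvesterTwoUpper

end
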